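import Summits.QuantumFields.YangMills.Theorems.TemperedCurvatureMoments.Negative.TieLoadBearing
import Summits.QuantumFields.YangMills.Theorems.IsotropyFromPowerCountingCurvatureDensitiesTameSector

/-!
# Disproof of `TemperedCurvatureMoments` (T, stmt-QuantumFields-17721) — standing disprover's work file

Findings (cdisprove cycle 1, 2026-08-17; refuter-cdisprove-stmt-QuantumFields-17721-0), indexed:

* §0 VERDICT.  **No kill; T resists every certified regime.**  T ⟺ order-zero temperedness of `𝔖ₙ|⁰𝒮` of the
  tied family with the weight `w(y) = C(1+‖y‖)^N (1+Σ_{i≠j}‖yᵢ−yⱼ‖⁻¹)^N` (the scheme enters only through `S₁`: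
  landed `stub_dominatedTieLimit` p108509 one way, `stub_latticeApproximants_of_continuousRegular` the other way
  for continuous densities).  Every certified inhabitant of the tie is a c-number family (`c ≡ 0`; `β ≡ 0` with
  ANY `c_k, m_k`; bounded `c_k`), for which T holds outright (§2).  A counterexample needs a NON-c-number Wilson
  scaling limit of the `tr F²` strings along a scheme with `β_k ≠ 0 ∧ |c_k| → ∞` at the same steps (§2,
  `temperedCurvatureMoments_iff_wildSector'`) — i.e. control of 4-d Yang–Mills at weak coupling (or at a
  hypothetical finite-`β` critical point): the existence problem.  Not misstated: typing read back clean
  (`∃ D` before `∀ f`; weight only at injective sites, no `0⁻¹`; non-injective Riemann terms vanish by flatness of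
  `F`; limits of real lattice numbers, so `S₁ n F ∈ ℝ` automatically).
* §1 LOAD-BEARING HYPOTHESES.  The TIE at order 4 is load-bearing (landed p141448, rattack seat:
  `not_TemperedCurvatureMomentsWithoutTieAt4/…WithoutTie/…ModelBlind`, junk family).  NEW here: the OS-side
  hypotheses (E0–E4 package, translations, hypercubic invariance, both gaps, eight frames, cone,
  `IsCompactSimpleLieGroup`) are IDLE in every certified proof — `TemperedCurvatureMomentsTieOnly → T` and every
  sector theorem of §2 uses the tie alone.  They cannot be shown load-bearing with certified inhabitants (a
  "T-without-X is false" theorem for X ≠ tie needs a tied non-c-number limit).  Open: is `T ↔ TieOnly`?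
* §2 CERTIFIED SECTORS (no counterexample there): `temperedApproximants_of_eventually_tame'` (tie +
  `∃B ∀ᶠk, β_k = 0 ∨ |c_k| ≤ B` ⇒ conclusion of T, `N = 0`; proposed as Negative/EventuallyTameSector.lean
  p144864), `temperedCurvatureMoments_iff_wildSector'`.  With E1 the junk loophole closes classically
  (Glimm–Jaffe 1987 Cor. 19.5.6: a small Euclidean ROTATION makes all times unequal, so OS0–3 Schwinger
  functions are real-analytic at non-coinciding points): T is exactly what must replace E1 at Step 0.
* §3 NATURAL STRENGTHENINGS.  (a) "T with the TRUE torus density `c_kⁿ W_k` as witness on the WHOLE box" meets the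
  SEAM obstruction: `W_k` is `(2L_k+1)`-periodic in every site, T's weight is not; a periodic box-tempered density
  is polynomially bounded in `a_k L_k` at the nearest-neighbour pair straddling the seam (`seam_bound`), so in the
  physical regime (nearest-neighbour renormalised moment `≍ a_k⁻⁸`) the untruncated true density is NOT k-uniformly
  box-tempered unless `a_k L_k ≳ a_k^{-8/N}` — the witness must be cut off near the seam / outside an inner box,
  exactly as line `Sketch`'s `MesoTempered` (inner half-box) does.  (b) "T uniform in `n`" is false already for
  c-number families with `|κ| > 1` (`κⁿ` against a weight whose minimum over `n`-point configurations grows only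
  polynomially in `n`) — nobody needs it; recorded.
* §4 TARGETS (line `Sketch`, card markov-shielding; registered skeleton `Lines/Sketch.lean`, 7 stubs).  The
  IDEATOR's `shielding_abstract` (SketchIdeator1.lean) is FALSE AS TYPED — its `Lⁿ` norms are Bochner integrals
  with no `Lⁿ` hypothesis: `not_shieldingAbstract_asTyped` (Lebesgue on `(0,1)`, `m = m₀`, `n = 2`,
  `φ = (x^{-1/2}, 1)`: `2 ≤ 0`), repaired `shielding_bdd`; proposed as Negative/ShieldingHolderAsTypedFalse.lean
  p144824.  The lead's REGISTERED `stub_shieldingHoelder` already carries `hφb : ∀ i, ∃ M, ∀ ω, |φ i ω| ≤ M` and is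
  TRUE (bounded conditional expectations make the Bochner `Lⁿ` norms honest) — no registered stub is misstated.
  Registered stubs read against certified regimes and geometry (all pass): A1 `stub_sepDensity` (flat ⇒
  vanishing-near-the-locus approximation + product partitions: true), A2 `stub_truncatedTieLimit` (equicontinuity
  on ⁰𝒮 from temperedness + flatness, `n²/(√2·dist(y,Λ))` controls the pair weight: true), A3
  `stub_temperedOfMeso` (dyadic scale below the minimal separation, `k₀(2^{-j})` diagonalisation, truncated sum =
  `latticeSchwinger` on separated compact tensors eventually: true), C1 `stub_condIndepCubes` (no plaquette meets
  two cubes at torus sup-distance `≥ 2R+2` in one coordinate; the collar of cube `i` misses cube `j` in that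
  coordinate, so `E[φᵢ|extᵢ]` is `σ(ext)`-measurable: true), C3 `stub_mesoOfShielded` (Euclidean `s`-separation
  ⇒ some coordinate `≥ s/(2a_k) ≥ 2⌊s/(8a_k)⌋+2` once `a_k ≤ s/8`; inner half-box ⇒ torus = box distance once
  `L_k ≥ 2R+1`; both eventual in `k`, allowed since `k₀` follows `s`: true), D `stub_shieldedMomentBound` = CH_n
  holds in every certified sector (β = 0: the shielded curvature IS the constant `κ_k` once `R ≥ 2`; bounded `c`:
  `|g| ≤ 2|c|M + |κ|`) and is the honest YM content (`p = 4` expected) — no certified attack exists.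
* §5 NEAR-MISSES (sorried, with the obstruction): `temperedApproximants_of_frequently_tame` (T is k-UNIFORM: a
  scheme tame along one subsequence and wild along another is not covered by §2; the fix is a witness built from
  the continuum density — needs the cell-average / a.e.-continuity form of `stub_latticeApproximants_of_…`);
  `temperedApproximants_transfer` (scheme-independence of T's conclusion; same missing lemma).
* §6 WHY IT RESISTS — one paragraph for the provers (end of file).

Landed negative lemmas for this crux (all under `Theorems/TemperedCurvatureMoments/Negative/`): p141448
TieLoadBearing (rattack), p144824 ShieldingHolderAsTypedFalse (ACCEPTED), p144864 EventuallyTameSector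
(ACCEPTED); proposed: p145229 PeriodicWitnessSeam (§3a: `torusMoment_update_period`, `seam_bound`,
`trueDensity_seam_bound`), p145272 MesoTameSector (`meso_of_eventually_tame`: the line's MESO(n) holds on
the eventually-tame sector, N = 0).  Import them in scratch checks:
`Summits.QuantumFields.YangMills.Theorems.TemperedCurvatureMoments.Negative.*`.
-/

noncomputable section

-- Mathlib's `SimplexCategory` instance `Fintype (Fin (x.len + 1))` matches `Fintype (Fin 4)` (tree-known
-- workaround, cf. the imported support files).
attribute [-instance] SimplexCategory.instFintypeToTypeOrderHomFinHAddNatLenOfNat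

namespace Summit.QuantumFields.YangMills.Cruxes.TemperedCurvatureMoments.Disproof

open scoped BigOperators SchwartzMap
open MeasureTheory Filter Topology Set
open Literature.MathematicalPhysics.QuantumLattice Literature.MathematicalPhysics.AQFT
  Literature.MathematicalPhysics.QuantumFieldTheory
open Literature.Probability.LatticeModels (box Site Torus.proj mem_box)
open Summit.QuantumFields.YangMills.Theorems.NPointIsotropy.Negative (E4 junk)
open Summit.QuantumFields.YangMills.Theorems.CurvatureBoostCovariance.Negative
  (OSPackage Translations Hypercubic Tie Gaps W1 EightFrameRP PlanarCone haarTraceRe proj_injOn_box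
    eventually_lt_side tie_apply_eq_zero_of_c_eq_zero)
open Summit.QuantumFields.YangMills.Theorems.OSLegsFromFemtoAndGap (torusMoment)
open Summit.QuantumFields.YangMills.Theorems.SoftKernelBoostCovariance.Sketch
  (temperedCurvatureMoments_of_trueDensity_tempered eventually_abs_renormalisedMean_le abs_trueDensity_le
    temperedCurvatureMoments_of_bddRenormalisation)
open Summit.QuantumFields.YangMills.Theorems.CurvatureDensities
  (torusMoment_zero_coupling wilsonTorusMean_zero_coupling)
open Summit.QuantumFields.YangMills.Theorems.TemperedCurvatureMoments.Negative
open Summit.QuantumFields.YangMills.Theses.IsotropyFromPowerCounting (TemperedCurvatureMoments)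

/-! ## §1 Load-bearing hypotheses -/

/-- (landed p141448) the tie at order 4 is load-bearing: junk family, `G = SU(2)`, zero scheme. -/
example : ¬ TemperedCurvatureMomentsWithoutTieAt4 := not_TemperedCurvatureMomentsWithoutTieAt4

/-- (landed p141448) the model-blind core of T is false. -/
example : ¬ TemperedCurvatureMomentsModelBlind := not_TemperedCurvatureMomentsModelBlind

/-- **T with the tie ONLY** (drop `IsCompactSimpleLieGroup`, E0–E4, translations, hypercubic invariance, both
gaps, the eight frames and the cone; keep the Wilson convergence clause): every certified proof of a sector of
T (§2; p140303; p140708) proves this stronger statement.  The disprover's reading: the OS-side clauses only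
restrict WHICH schemes are admissible (those whose Wilson limit extends to a nice `S₁`); no certified scheme
is excluded by them, so they are possibly unnecessary.  Whether `T ↔ TieOnly` is open. -/
def TemperedCurvatureMomentsTieOnly : Prop :=
  ∀ (G : Type) [Group G] [TopologicalSpace G] [IsTopologicalGroup G] [CompactSpace G]
    [MeasurableSpace G] [BorelSpace G] (r : LatticeRep G) (sch : SpeciesScheme (YMSpecies G))
    (S₁ : SchwingerFamily E4), Tie r sch S₁ → ∀ n : ℕ, 0 < n → TemperedApproximants sch.a sch.L S₁ n

/-- `TieOnly → T`. [folklore] -/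
theorem temperedCurvatureMoments_of_tieOnly (h : TemperedCurvatureMomentsTieOnly) :
    TemperedCurvatureMoments := by
  rw [temperedCurvatureMoments_iff]
  intro G _ _ _ _ _ _ _ r sch S₁ hW _ _ n hn
  exact h G r sch S₁ hW.1 n hn

/-! ## §2 Certified sectors: no counterexample on the eventually-tame sector (proposed p144864) -/

section Sectors

variable {G : Type} [Group G] [TopologicalSpace G] [IsTopologicalGroup G] [CompactSpace G]
  [MeasurableSpace G] [BorelSpace G]

/-- **The degree-`n` conclusion of T on every EVENTUALLY-TAME scheme** (tie + `∃ B, ∀ᶠ k, β_k = 0 ∨ |c_k| ≤ B`),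
witness the true density `c_kⁿ W_k`, `N = 0`.  At zero-coupling steps `c_k, m_k` are ARBITRARY.  (Twin of the
proposed `Negative/EventuallyTameSector.lean`, p144864.) -/
theorem temperedApproximants_of_eventually_tame' (r : LatticeRep G) (sch : SpeciesScheme (YMSpecies G))
    (S₁ : SchwingerFamily E4) (htie : Tie r sch S₁)
    (h : ∃ B : ℝ, ∀ᶠ k in atTop, sch.β k = 0 ∨ |sch.c r.curvature k| ≤ B) {n : ℕ} (hn : 0 < n) :
    TemperedApproximants sch.a sch.L S₁ n := by
  obtain ⟨B, hB⟩ := h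
  obtain ⟨k₃, hk₃⟩ := eventually_atTop.1 hB
  obtain ⟨M, hM⟩ := r.curvature.bounded
  obtain ⟨K, hK⟩ := eventually_abs_renormalisedMean_le r sch S₁ htie
  obtain ⟨k₁, hk₁⟩ := eventually_atTop.1 hK
  obtain ⟨k₂, hk₂⟩ := eventually_atTop.1 (eventually_lt_side sch n)
  refine temperedCurvatureMoments_of_trueDensity_tempered r sch S₁ htie hn
    ⟨|2 * B * M + K| ^ n + |K| ^ n + 1, 0, max (max k₁ k₂) k₃, by positivity, fun k hk x hx hxinj => ?_⟩
  have hk1 : k₁ ≤ k := ((le_max_left _ _).trans (le_max_left _ _)).trans hk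
  have hk2 : k₂ ≤ k := ((le_max_right _ _).trans (le_max_left _ _)).trans hk
  have hk3 : k₃ ≤ k := (le_max_right _ _).trans hk
  have hKn : 0 ≤ |K| ^ n := pow_nonneg (abs_nonneg _) n
  have hBn : 0 ≤ |2 * B * M + K| ^ n := pow_nonneg (abs_nonneg _) n
  simp only [pow_zero, mul_one]
  rcases hk₃ k hk3 with hβ | hc
  · have hside : n < 2 * sch.L k + 1 := hk₂ k hk2
    have hL : 0 < sch.L k := by omega
    have hinj' : Function.Injective fun i => Torus.proj (2 * sch.L k + 1) (x i) :=
      fun i j hij => hxinj (proj_injOn_box (sch.L k) (hx i) (hx j) hij)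
    have hκ := hk₁ k hk1
    rw [hβ, wilsonTorusMean_zero_coupling r hL] at hκ
    rw [hβ, torusMoment_zero_coupling r (sch.L k) _ x hinj' hside, ← mul_pow, abs_pow]
    calc |sch.c r.curvature k * (6 * haarTraceRe r.ρ - sch.m r.curvature k)| ^ n
        ≤ |K| ^ n := pow_le_pow_left₀ (abs_nonneg _) (hκ.trans (le_abs_self K)) n
      _ ≤ |2 * B * M + K| ^ n + |K| ^ n + 1 := by linarith
  · calc |sch.c r.curvature k ^ n *
            torusMoment r.ρ (sch.β k) (sch.L k) r.curvature.F (sch.m r.curvature k) x|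
        ≤ (2 * B * M + K) ^ n := abs_trueDensity_le r sch hM k hc (hk₁ k hk1) x
      _ ≤ |2 * B * M + K| ^ n := by rw [← abs_pow]; exact le_abs_self _
      _ ≤ |2 * B * M + K| ^ n + |K| ^ n + 1 := by linarith

/-- **An obstruction to T forces wild steps infinitely often**: `β_k ≠ 0 ∧ |c_k| > B` at the same `k`, for every
`B`, frequently. -/
theorem frequently_wild_of_not_temperedApproximants' (r : LatticeRep G) (sch : SpeciesScheme (YMSpecies G))
    (S₁ : SchwingerFamily E4) (htie : Tie r sch S₁) {n : ℕ} (hn : 0 < n)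
    (h : ¬ TemperedApproximants sch.a sch.L S₁ n) (B : ℝ) :
    ∃ᶠ k in atTop, sch.β k ≠ 0 ∧ B < |sch.c r.curvature k| := by
  by_contra hnot
  refine h (temperedApproximants_of_eventually_tame' r sch S₁ htie ⟨B, ?_⟩ hn)
  rw [Filter.not_frequently] at hnot
  refine hnot.mono fun k hk => ?_
  by_cases hβ : sch.β k = 0
  · exact Or.inl hβ
  · exact Or.inr (not_lt.1 fun hlt => hk ⟨hβ, hlt⟩)

/-- Every certified sector is in fact a proof of the corresponding sector of `TieOnly` (§1): here the
eventually-tame one. -/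
theorem tieOnly_eventuallyTameSector :
    ∀ (G : Type) [Group G] [TopologicalSpace G] [IsTopologicalGroup G] [CompactSpace G]
      [MeasurableSpace G] [BorelSpace G] (r : LatticeRep G) (sch : SpeciesScheme (YMSpecies G))
      (S₁ : SchwingerFamily E4), Tie r sch S₁ →
      (∃ B : ℝ, ∀ᶠ k in atTop, sch.β k = 0 ∨ |sch.c r.curvature k| ≤ B) →
      ∀ n : ℕ, 0 < n → TemperedApproximants sch.a sch.L S₁ n :=
  fun _G _ _ _ _ _ _ r sch S₁ htie h _n hn => temperedApproximants_of_eventually_tame' r sch S₁ htie h hn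

end Sectors

/-- **T is equivalent to its restriction to the WILD SECTOR** `∀ B, ∃ᶠ k, β_k ≠ 0 ∧ B < |c_k|`: the only place a
counterexample can live, and the regime where no Wilson limit is constructed. -/
theorem temperedCurvatureMoments_iff_wildSector' :
    TemperedCurvatureMoments ↔
      ∀ (G : Type) [Group G] [TopologicalSpace G] [IsTopologicalGroup G] [CompactSpace G]
        [MeasurableSpace G] [BorelSpace G], IsCompactSimpleLieGroup G →
        ∀ (r : LatticeRep G) (sch : SpeciesScheme (YMSpecies G)) (S₁ : SchwingerFamily E4),
          W1 r sch S₁ → EightFrameRP S₁ → PlanarCone S₁ →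
          (∀ B : ℝ, ∃ᶠ k in atTop, sch.β k ≠ 0 ∧ B < |sch.c r.curvature k|) →
          ∀ n : ℕ, 0 < n → TemperedApproximants sch.a sch.L S₁ n := by
  rw [temperedCurvatureMoments_iff]
  constructor
  · intro h G _ _ _ _ _ _ hG r sch S₁ hW h8 hC _ n hn
    exact h G hG r sch S₁ hW h8 hC n hn
  · intro h G _ _ _ _ _ _ hG r sch S₁ hW h8 hC n hn
    by_contra hT
    exact hT (h G hG r sch S₁ hW h8 hC (frequently_wild_of_not_temperedApproximants' r sch S₁ hW.1 hn hT) n hn)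

/-! ## §3 Natural strengthenings

### §3a The seam: a PERIODIC density that is box-tempered is polynomially bounded in `a L` at the nearest-neighbour
pair straddling the seam

The intended witness of T is the true renormalised torus density `D_k = c_kⁿ W_k`, `W_k = torusMoment …`, which is
`(2L_k+1)`-PERIODIC in every site (the smeared field reads the periodic lift `torusLift`).  T's weight is NOT
periodic: it allows blow-up only near the PHYSICAL diagonal `a_k xᵢ = a_k xⱼ`.  The pair `(L e₀, (L+1) e₀)` is a
nearest-neighbour pair of `ℤ⁴`; its periodic image `(L e₀, −L e₀)` lies in the box at physical separation `2aL`,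
where the weight is `≤ C (1 + aL)^N · 2^N`.  Hence (lemma below) a periodic density tempered on the box with
`(C, N)` has `|D(L e₀, (L+1) e₀)| ≤ C 2^N (1 + aL)^N`.  For the true density (periodic AND translation invariant)
this is the nearest-neighbour renormalised two-point moment `c_k² W_k(0, e₀)`, which in the physical regime is
`≍ a_k⁻⁸`: the untruncated true density can be k-uniformly box-tempered only if `(a_k L_k)^N ≳ a_k⁻⁸`, false for
every scheme with `a_k L_k → ∞` slower than every power of `a_k⁻¹`.  Moral for provers: the witness `D` must be
the true density CUT OFF near the seam (or outside an inner box `box 4 (L_k/2)`, where torus and box distances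
agree) — as `MesoTempered` of line `Sketch` does; a statement bounding `c_kⁿ W_k` with the box weight on the whole
box is false in the regime of interest (not certifiable today: no physical-regime inhabitant is constructed). -/

/-- `siteToE` of an integer multiple of a basis vector. -/
theorem siteToE_zsmul_single (c : ℤ) (i : Fin 4) :
    siteToE ((c • Pi.single i (1 : ℤ) : Site 4)) = (c : ℝ) • EuclideanSpace.single i (1 : ℝ) := by
  ext j
  rw [siteToE_apply]
  by_cases h : j = i
  · subst h; simp
  · simp [h]

/-- Norm of `a • siteToE (c • eᵢ)`. -/
theorem norm_smul_siteToE_zsmul_single (a : ℝ) (c : ℤ) (i : Fin 4) :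
    ‖a • siteToE ((c • Pi.single i (1 : ℤ) : Site 4))‖ = |a| * |(c : ℝ)| := by
  have hs : ‖(EuclideanSpace.single i (1 : ℝ) : EuclideanSpace ℝ (Fin 4))‖ = 1 := by simp
  rw [siteToE_zsmul_single, norm_smul, norm_smul, hs, mul_one, Real.norm_eq_abs, Real.norm_eq_abs]

/-- **Seam bound.**  Let `D : (ℤ⁴)² → ℝ` satisfy T's degree-two tempered bound on the box `[-L, L]⁴` with constants
`(C, N)` at spacing `a` (`a L ≥ 1`), and let `D` take the same value at the nearest-neighbour pair
`(L e₀, (L+1) e₀)` as at its periodic image `(L e₀, −L e₀)` (one instance of `(2L+1)`-periodicity in the second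
site).  Then `|D (L e₀, (L+1) e₀)| ≤ C · (1 + a L)^N · 2^N` — polynomial in `a L`, with no access to the
`‖·‖⁻¹`-singularity of the weight. -/
theorem seam_bound {C a : ℝ} {N L : ℕ} (hC : 0 ≤ C) (ha : 0 < a) (hL : 1 ≤ L) (haL : 1 ≤ a * L)
    (D : (Fin 2 → Site 4) → ℝ)
    (hper : D ![((L : ℤ) • Pi.single 0 1 : Site 4), (((L : ℤ) + 1) • Pi.single 0 1 : Site 4)] =
      D ![((L : ℤ) • Pi.single 0 1 : Site 4), ((-(L : ℤ)) • Pi.single 0 1 : Site 4)])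
    (hD : ∀ x : Fin 2 → Site 4, (∀ i, x i ∈ box 4 L) → Function.Injective x →
      |D x| ≤ C * (1 + ‖fun i => a • siteToE (x i)‖) ^ N *
        (1 + ∑ i, ∑ j ∈ Finset.univ.erase i, ‖a • siteToE (x i) - a • siteToE (x j)‖⁻¹) ^ N) :
    |D ![((L : ℤ) • Pi.single 0 1 : Site 4), (((L : ℤ) + 1) • Pi.single 0 1 : Site 4)]| ≤
      C * (1 + a * L) ^ N * 2 ^ N := by
  rw [hper]
  set x : Fin 2 → Site 4 := ![((L : ℤ) • Pi.single 0 1 : Site 4), ((-(L : ℤ)) • Pi.single 0 1 : Site 4)]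
    with hx
  have hx0 : x 0 = (L : ℤ) • Pi.single 0 1 := rfl
  have hx1 : x 1 = (-(L : ℤ)) • Pi.single 0 1 := rfl
  have hbox : ∀ i, x i ∈ box 4 L := by
    intro i
    fin_cases i
    · show ((L : ℤ) • Pi.single 0 1 : Site 4) ∈ box 4 L
      rw [mem_box]; intro j
      by_cases hj : j = 0
      · subst hj; simp
      · simp [Pi.single_eq_of_ne hj]
    · show ((-(L : ℤ)) • Pi.single 0 1 : Site 4) ∈ box 4 L
      rw [mem_box]; intro j
      by_cases hj : j = 0
      · subst hj; simp
      · simp [Pi.single_eq_of_ne hj]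
  have hinj : Function.Injective x := by
    intro i j hij
    fin_cases i <;> fin_cases j
    · rfl
    · exfalso
      have h := congrFun hij 0
      simp [hx0, hx1] at h
      omega
    · exfalso
      have h := congrFun hij 0
      simp [hx0, hx1] at h
      omega
    · rfl
  have hbd := hD x hbox hinj
  -- the sup norm of the positions is `a L`
  have haL0 : 0 < a * L := lt_of_lt_of_le one_pos haL
  have hnorm : ‖fun i => a • siteToE (x i)‖ ≤ a * L := by
    refine (pi_norm_le_iff_of_nonneg (by positivity)).2 fun i => ?_
    fin_cases i
    · show ‖a • siteToE (x 0)‖ ≤ a * L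
      rw [hx0, norm_smul_siteToE_zsmul_single, abs_of_pos ha]
      simp
    · show ‖a • siteToE (x 1)‖ ≤ a * L
      rw [hx1, norm_smul_siteToE_zsmul_single, abs_of_pos ha]
      simp
  -- the pair sum is `2 / (2 a L) = 1/(a L) ≤ 1`
  have hdiff : ‖a • siteToE (x 0) - a • siteToE (x 1)‖ = 2 * (a * L) := by
    have hs : ‖(EuclideanSpace.single (0 : Fin 4) (1 : ℝ) : EuclideanSpace ℝ (Fin 4))‖ = 1 := by simp
    have h2L : (((L : ℤ) : ℝ) - ((-(L : ℤ) : ℤ) : ℝ)) = 2 * (L : ℝ) := by push_cast; ring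
    rw [hx0, hx1, ← smul_sub, siteToE_zsmul_single, siteToE_zsmul_single, ← sub_smul, norm_smul, norm_smul,
      hs, mul_one, Real.norm_eq_abs, Real.norm_eq_abs, abs_of_pos ha, h2L,
      abs_of_nonneg (by positivity : (0 : ℝ) ≤ 2 * (L : ℝ))]
    ring
  have hdiff' : ‖a • siteToE (x 1) - a • siteToE (x 0)‖ = 2 * (a * L) := by
    rw [norm_sub_rev, hdiff]
  have hsum : ∑ i, ∑ j ∈ Finset.univ.erase i, ‖a • siteToE (x i) - a • siteToE (x j)‖⁻¹ = (a * L)⁻¹ := by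
    rw [Fin.sum_univ_two]
    have h0 : (Finset.univ : Finset (Fin 2)).erase 0 = {1} := by decide
    have h1 : (Finset.univ : Finset (Fin 2)).erase 1 = {0} := by decide
    rw [h0, h1, Finset.sum_singleton, Finset.sum_singleton, hdiff, hdiff']
    field_simp
    norm_num
  have hsum_le : (1 + ∑ i, ∑ j ∈ Finset.univ.erase i, ‖a • siteToE (x i) - a • siteToE (x j)‖⁻¹) ≤ 2 := by
    rw [hsum]
    have : (a * L)⁻¹ ≤ 1 := inv_le_one_of_one_le₀ haL
    linarith
  calc |D x| ≤ C * (1 + ‖fun i => a • siteToE (x i)‖) ^ N *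
        (1 + ∑ i, ∑ j ∈ Finset.univ.erase i, ‖a • siteToE (x i) - a • siteToE (x j)‖⁻¹) ^ N := hbd
    _ ≤ C * (1 + a * L) ^ N * 2 ^ N := by
        have hS0 : 0 ≤ ∑ i, ∑ j ∈ Finset.univ.erase i, ‖a • siteToE (x i) - a • siteToE (x j)‖⁻¹ :=
          Finset.sum_nonneg fun i _ => Finset.sum_nonneg fun j _ => inv_nonneg.2 (norm_nonneg _)
        have h1 : (1 + ‖fun i => a • siteToE (x i)‖) ^ N ≤ (1 + a * L) ^ N :=
          pow_le_pow_left₀ (by positivity) (by linarith [hnorm]) N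
        have h2 : (1 + ∑ i, ∑ j ∈ Finset.univ.erase i, ‖a • siteToE (x i) - a • siteToE (x j)‖⁻¹) ^ N ≤
            2 ^ N := pow_le_pow_left₀ (by linarith) hsum_le N
        exact mul_le_mul (mul_le_mul_of_nonneg_left h1 hC) h2 (pow_nonneg (by linarith) N)
          (mul_nonneg hC (pow_nonneg (by positivity) N))

/-! ## §4 Targets — line `Sketch` (card markov-shielding), stubs read from `SketchIdeator1.lean` -/

/-- Lebesgue measure restricted to `(0,1)` (local notation). -/
local notation "μ01" => (Measure.restrict (volume : Measure ℝ) (Set.Ioo (0 : ℝ) 1))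

/-- `μ01` is a probability measure. -/
theorem isProbabilityMeasure_μ01 : IsProbabilityMeasure μ01 :=
  ⟨by simp [Real.volume_Ioo]⟩

/-- `x^{-1/2}` is integrable on `(0,1)`. -/
theorem rpow_neg_half_integrable : Integrable (fun x : ℝ => x ^ (-(1 / 2 : ℝ))) μ01 :=
  (intervalIntegral.integrableOn_Ioo_rpow_iff one_pos).2 (by norm_num)

/-- `∫₀¹ x^{-1/2} dx = 2`. -/
theorem integral_rpow_neg_half : ∫ x, (fun x : ℝ => x ^ (-(1 / 2 : ℝ))) x ∂μ01 = 2 := by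
  have h1 : ∫ x, (fun x : ℝ => x ^ (-(1 / 2 : ℝ))) x ∂μ01 = ∫ x in Ioc (0 : ℝ) 1, x ^ (-(1 / 2 : ℝ)) := by
    rw [integral_Ioc_eq_integral_Ioo]
  rw [h1, ← intervalIntegral.integral_of_le zero_le_one, integral_rpow (Or.inl (by norm_num))]
  norm_num [Real.zero_rpow]

/-- `|x^{-1/2}|² = x^{-1}` is NOT integrable on `(0,1)`. -/
theorem not_integrable_rpow_neg_half_sq :
    ¬ Integrable (fun x : ℝ => |(fun x : ℝ => x ^ (-(1 / 2 : ℝ))) x| ^ (2 : ℕ)) μ01 := by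
  intro h
  have h' : IntegrableOn (fun x : ℝ => x ^ (-1 : ℝ)) (Ioo (0 : ℝ) 1) := by
    refine (integrableOn_congr_fun (fun x hx => ?_) measurableSet_Ioo).1 h
    have hx0 : 0 < x := hx.1
    simp only
    rw [abs_of_nonneg (Real.rpow_nonneg hx0.le _), ← Real.rpow_natCast, ← Real.rpow_mul hx0.le]
    norm_num
  have := (intervalIntegral.integrableOn_Ioo_rpow_iff one_pos).1 h'
  norm_num at this

/-- **KILLED AS TYPED: the ideator's stub `shielding_abstract` (SketchIdeator1.lean; the registered
`stub_shieldingHoelder` of `Lines/Sketch.lean` adds boundedness `hφb` and is fine).**  The refuted statement is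
the ideator's stub verbatim at universe `0`: tower property + generalised Hölder with the `Lⁿ` norms written as Bochner
integrals of `|μ[φ i|m]|ⁿ` and no `Lⁿ` hypothesis on the conditional expectations.  Witness: Lebesgue on `(0,1)`,
`m = m₀` (so `μ[φ|m] = φ` and conditional independence is automatic), `n = 2`, `φ = (x^{-1/2}, 1)`: the left side is
`∫₀¹ x^{-1/2} = 2`, the right side is `(∫|φ₀|²)^{1/2} · 1 = 0^{1/2} = 0` (Bochner junk value).  Repair: add
`∀ i, ∀ᵐ ω, |φ i ω| ≤ B i` (the only case `mesoTempered_of_shieldedMomentBound` feeds) — `shielding_bdd` below —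
or `MemLp (μ[φ i|m]) n μ`, or write the right side with `eLpNorm`.  (Proposed: Negative/ShieldingHolderAsTypedFalse.lean,
p144824.) -/
theorem not_shieldingAbstract_asTyped :
    ¬ ∀ {Ω : Type} {m m0 : MeasurableSpace Ω} (_hm : m ≤ m0) (μ : Measure Ω) [IsProbabilityMeasure μ] {n : ℕ}
        (_hn : 0 < n) (φ : Fin n → Ω → ℝ) (_hφ : ∀ i, Integrable (φ i) μ)
        (_hprod : Integrable (fun ω => ∏ i, φ i ω) μ)
        (_hci : μ[(fun ω => ∏ i, φ i ω) | m] =ᵐ[μ] fun ω => ∏ i, (μ[φ i | m]) ω),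
        |∫ ω, ∏ i, φ i ω ∂μ| ≤ ∏ i, (∫ ω, |(μ[φ i | m]) ω| ^ n ∂μ) ^ ((n : ℝ)⁻¹) := by
  intro h
  haveI : IsProbabilityMeasure μ01 := isProbabilityMeasure_μ01
  have hφ : ∀ i, Integrable ((![fun x : ℝ => x ^ (-(1 / 2 : ℝ)), fun _ => 1] : Fin 2 → ℝ → ℝ) i) μ01 := by
    intro i
    fin_cases i
    · exact rpow_neg_half_integrable
    · exact integrable_const _
  have hprodfun : (fun ω => ∏ i, (![fun x : ℝ => x ^ (-(1 / 2 : ℝ)), fun _ => 1] : Fin 2 → ℝ → ℝ) i ω) =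
      fun x : ℝ => x ^ (-(1 / 2 : ℝ)) := by
    funext ω
    simp [Fin.prod_univ_two]
  have hprod : Integrable
      (fun ω => ∏ i, (![fun x : ℝ => x ^ (-(1 / 2 : ℝ)), fun _ => 1] : Fin 2 → ℝ → ℝ) i ω) μ01 := by
    rw [hprodfun]; exact rpow_neg_half_integrable
  have hm : (inferInstance : MeasurableSpace ℝ) ≤ (inferInstance : MeasurableSpace ℝ) := le_rfl
  have hc0 : μ01[(fun x : ℝ => x ^ (-(1 / 2 : ℝ))) | (inferInstance : MeasurableSpace ℝ)] =
      fun x : ℝ => x ^ (-(1 / 2 : ℝ)) :=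
    condExp_of_stronglyMeasurable hm (measurable_id.pow_const _).stronglyMeasurable rpow_neg_half_integrable
  have hc1 : μ01[(fun _ : ℝ => (1 : ℝ)) | (inferInstance : MeasurableSpace ℝ)] = fun _ => 1 :=
    condExp_const hm (1 : ℝ)
  have hci : μ01[(fun ω => ∏ i, (![fun x : ℝ => x ^ (-(1 / 2 : ℝ)), fun _ => 1] : Fin 2 → ℝ → ℝ) i ω) |
        (inferInstance : MeasurableSpace ℝ)] =ᵐ[μ01]
      fun ω => ∏ i, (μ01[(![fun x : ℝ => x ^ (-(1 / 2 : ℝ)), fun _ => 1] : Fin 2 → ℝ → ℝ) i |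
        (inferInstance : MeasurableSpace ℝ)]) ω := by
    refine Filter.EventuallyEq.of_eq ?_
    rw [hprodfun]
    funext ω
    simp only [Fin.prod_univ_two, Matrix.cons_val_zero, Matrix.cons_val_one, Matrix.cons_val_fin_one]
    rw [hc0, hc1]
    simp
  have key := h hm μ01 (n := 2) two_pos _ hφ hprod hci
  have hL : |∫ ω, ∏ i, (![fun x : ℝ => x ^ (-(1 / 2 : ℝ)), fun _ => 1] : Fin 2 → ℝ → ℝ) i ω ∂μ01| = 2 := by
    rw [hprodfun, integral_rpow_neg_half]; norm_num
  have hR : ∏ i, (∫ ω, |(μ01[(![fun x : ℝ => x ^ (-(1 / 2 : ℝ)), fun _ => 1] : Fin 2 → ℝ → ℝ) i |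
      (inferInstance : MeasurableSpace ℝ)]) ω| ^ (2 : ℕ) ∂μ01) ^ (((2 : ℕ) : ℝ)⁻¹) = 0 := by
    rw [Fin.prod_univ_two]
    have h0 : (∫ ω, |(μ01[(![fun x : ℝ => x ^ (-(1 / 2 : ℝ)), fun _ => 1] : Fin 2 → ℝ → ℝ) 0 |
        (inferInstance : MeasurableSpace ℝ)]) ω| ^ (2 : ℕ) ∂μ01) = 0 := by
      have : (![fun x : ℝ => x ^ (-(1 / 2 : ℝ)), fun _ => 1] : Fin 2 → ℝ → ℝ) 0 =
          fun x : ℝ => x ^ (-(1 / 2 : ℝ)) := rfl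
      rw [this, hc0]
      exact integral_undef not_integrable_rpow_neg_half_sq
    rw [h0, Real.zero_rpow (by norm_num)]
    simp
  rw [hL, hR] at key
  norm_num at key

/-- **The repaired shielding inequality (bounded observables)**: `|φ i| ≤ B i` a.e. and conditional independence
in the product sense give `|∫ ∏ φ i| ≤ ∏ B i` (tower property; each `μ[φ i|m]` is a.e. bounded by `B i`, so its
`Lⁿ` norm is honest).  This is all `mesoTempered_of_shieldedMomentBound` needs. -/
theorem shielding_bdd {Ω : Type*} {m m0 : MeasurableSpace Ω} (hm : m ≤ m0) (μ : Measure Ω)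
    [IsProbabilityMeasure μ] {n : ℕ} (φ : Fin n → Ω → ℝ) (B : Fin n → ℝ)
    (hB : ∀ i, ∀ᵐ ω ∂μ, |φ i ω| ≤ B i)
    (hci : μ[(fun ω => ∏ i, φ i ω) | m] =ᵐ[μ] fun ω => ∏ i, (μ[φ i | m]) ω) :
    |∫ ω, ∏ i, φ i ω ∂μ| ≤ ∏ i, B i := by
  have hbd : ∀ i, ∀ᵐ ω ∂μ, |(μ[φ i | m]) ω| ≤ B i := fun i =>
    ae_bdd_abs_condExp_of_ae_bdd_abs (m := m) (hB i)
  have htower : ∫ ω, ∏ i, φ i ω ∂μ = ∫ ω, (μ[(fun ω => ∏ i, φ i ω) | m]) ω ∂μ :=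
    (integral_condExp hm).symm
  rw [htower, integral_congr_ae hci]
  have hall : ∀ᵐ ω ∂μ, ∀ i, |(μ[φ i | m]) ω| ≤ B i := ae_all_iff.2 hbd
  calc |∫ ω, ∏ i, (μ[φ i | m]) ω ∂μ| ≤ ∫ ω, |∏ i, (μ[φ i | m]) ω| ∂μ := abs_integral_le_integral_abs
    _ ≤ ∫ _ω, ∏ i, B i ∂μ := by
        refine integral_mono_of_nonneg (Eventually.of_forall fun _ => abs_nonneg _) (integrable_const _) ?_
        filter_upwards [hall] with ω hω
        rw [Finset.abs_prod]
        exact Finset.prod_le_prod (fun i _ => abs_nonneg _) fun i _ => hω i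
    _ = ∏ i, B i := by simp

/-! ## §5 Near-misses (sorried; obstruction in the docstring) -/

section NearMisses

variable {G : Type} [Group G] [TopologicalSpace G] [IsTopologicalGroup G] [CompactSpace G]
  [MeasurableSpace G] [BorelSpace G]

/-- NEAR-MISS 1 (**frequently tame ⇒ T?**).  T is k-UNIFORM (`∀ k ≥ k₀`), so §2 absorbs only EVENTUAL tameness.
For a scheme tame along one subsequence and wild along another the corollary `NPointRegular` still holds (landed
`nPointRegular_of_frequently_tame`: pass to the tame subsequence) and the density is even `L^∞`
(`norm_schwinger_le_of_bddRenormalisation` along the subsequence), but a witness `D_k` at the WILD steps cannot be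
the true density (uncontrolled there); it must be manufactured from the continuum density `W` — cell averages
`D_k x := ⨍_{a_k x + [0,a_k)^{4n}} Re W`.  Obstruction: the tree's continuum⇒lattice engine
`stub_latticeApproximants_of_continuousRegular` wants `W` CONTINUOUS off the coincidence locus (Riemann sums of an
a.e.-continuous integrand); for a merely bounded measurable `W` one needs the cell-average variant
(`∫ F_k W → ∫ F W` for the piecewise-constant samplings `F_k → F`, dominated convergence).  Expected TRUE. -/
theorem temperedApproximants_of_frequently_tame (r : LatticeRep G) (sch : SpeciesScheme (YMSpecies G))
    (S₁ : SchwingerFamily E4) (htie : Tie r sch S₁)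
    (h : ∃ B : ℝ, ∃ᶠ k in atTop, sch.β k = 0 ∨ |sch.c r.curvature k| ≤ B) {n : ℕ} (hn : 0 < n) :
    TemperedApproximants sch.a sch.L S₁ n := by
  sorry

/-- NEAR-MISS 2 (**scheme-independence of T's conclusion**).  `TemperedApproximants a L S₁ n` for ONE admissible
`(a, L)` should give it for EVERY admissible `(a', L')`: approximants ⇒ `|S₁ n F| ≤ ∫ |F| w` on off-diagonal real
tensors (landed `stub_dominatedTieLimit`) ⇒ `𝔖ₙ|⁰𝒮 = W · Leb` with `|W| ≤ w` a.e. ⇒ cell-average approximants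
along `(a', L')`.  Same missing lemma as near-miss 1 (a.e.-bounded, not continuous, density).  Consequence when
closed: the data `(sch.a, sch.L)` in T are idle — T is a property of `S₁|⁰𝒮` alone (order-zero temperedness),
which is how the provers should (and do: Step 0) read it. -/
theorem temperedApproximants_transfer {a a' : ℕ → ℝ} {L L' : ℕ → ℕ} (S₁ : SchwingerFamily E4)
    (ha : ∀ k, 0 < a k) (ha₀ : Tendsto a atTop (𝓝 0)) (haL : Tendsto (fun k => a k * L k) atTop atTop)
    (ha' : ∀ k, 0 < a' k) (ha₀' : Tendsto a' atTop (𝓝 0)) (haL' : Tendsto (fun k => a' k * L' k) atTop atTop)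
    {n : ℕ} (hn : 0 < n) (h : TemperedApproximants a L S₁ n) : TemperedApproximants a' L' S₁ n := by
  sorry

end NearMisses

/-! ## §6 Why T resists (for the provers)

1. T's content is exactly ORDER-ZERO temperedness of `𝔖ₙ|⁰𝒮` of the Wilson limit of the `tr F²` strings, `n ≥ 3`
   (degrees 1, 2 are landed: p140708, p140940 ⇐ K), in the regime `β_k ≠ 0 ∧ |c_k| → ∞` (§2).  In that regime no
   inhabitant of the tie exists in the tree or in print (grounder: uniform tempered lattice densities are printed
   only for super-renormalisable scalars, Glimm–Jaffe 1987 Ch. 9 / Brydges–Fröhlich–Sokal 1983; Bałaban's YM₄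
   papers stop at UV stability of effective actions, no moment densities).
2. Every c-number family satisfies T (witness `κ_kⁿ`), so the Gaussian/GFF and `β = 0` batteries of the sibling
   cruxes cannot bite; the junk family bites only the tie-free forms (p141448).
3. With E1 the statement would be classical (OS0–3 ⇒ real-analytic Schwinger functions at non-coinciding points
   by a small rotation, Glimm–Jaffe Cor. 19.5.6, plus OS-II linear-growth pointwise bounds); WITHOUT E1 the
   equal-time-in-all-sixteen-frames null set is invisible to reflection positivity, and T is precisely the
   assertion that the Wilson limit does not charge it.  So T is the honest substitute for E1 at Step 0, neither
   weaker nor stronger than what the route needs (`stub_stepZeroByDegrees` p142709 consumes only "𝔖ₙ|⁰𝒮 is a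
   function for n ≥ 3").
4. For the picked line `Sketch`: the reductions T ⟸ MESO ⟸ CH_n are sound in every certified sector; the only
   defect found is the Bochner-junk typing of `shielding_abstract` (§4, repaired).  Two design points certified
   here: the inner half-box of `MesoTempered` is NECESSARY (§3a seam), and `MesoTempered`'s uniform bound
   `C s^{-N}` with no growth allowance at large `‖a_k x‖` is consistent with every certified sector (c-number
   families are bounded) — in the physical regime it additionally encodes clustering of the untruncated moments to
   `κⁿ`, which the degree-one tie makes plausible but which CH_n must deliver.
-/

end Summit.QuantumFields.YangMills.Cruxes.TemperedCurvatureMoments.Disproof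

end
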